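import Summits.Ventures.LatticeQCDFlow.Scoring.SU2CharacterConvolution
import HarnessLib

/-!
# SU(2): rotation invariance of the axis law, the general two-angle disintegration, and the character convolution identity `∫ χ_m(x⁻¹y) χ_n(y) dy = [m = n]·χ_n(x)/(n+1)` for EVERY `x ∈ SU(2)`

HONEST FRAMING: exact (Metropolis-corrected) sampling algorithms for lattice gauge theory;
figures of merit are autocorrelation/cost numbers at stated couplings and volumes; no
continuum-physics claim.

Venture `LatticeQCDFlow` (cell pub-lqcd), sub-topic `Scoring`; FANOUT row 5 (`s0-sun-a`), GEN-9.
NEW WORK of the cell (placement rule).  Step 4b of row 5's route to the exact SU(2) torus formula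
without Peter–Weyl: `Scoring/SU2CharacterConvolution.lean` proved the convolution identity of the
characters `χ_n = U_n(a₀)` at the one-parameter subgroup `x_θ = cos θ + sin θ Z₁`; here it is
extended to every group element.

* §1 **`uniformSphere_map_inner`** — Archimedes in EVERY direction: for a unit vector `m̂ ∈ ℝ³`,
  the law of `⟨m̂, n̂⟩` under row 9's `uniformSphere` on `S²` is `½·Lebesgue|[−1,1]` (the coordinate
  case `SU2AxisCoordinateLaw.uniformSphere_map_coord_zero` transported by the Householder reflection
  taking `m̂` to `e₀`: the standard Gaussian of `ℝ³` is invariant under linear isometries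
  (`ProbabilityTheory.stdGaussian_map`), its direction is `uniformSphere`-distributed
  (`Exactness.stdGaussian_map_dirSphere`), and `dirSphere` is equivariant).
* §2 **`map_a0_axisProj_haar`** / **`integral_a0_innerVec_haar`** — under Haar on SU(2), for every
  unit `m̂`: `(a₀, ⟨m̂, n̂⟩)` has the product law `semicircleLaw ⊗ ½·Lebesgue|[−1,1]`, and for
  continuous `F`,
  `∫ F(a₀(U), ⟨m̂, x⃗(U)⟩) dHaar = ∫_{−1}^{1} (½∫_{−1}^{1} F(t, √(1−t²)s) ds)(2/π)√(1−t²) dt`.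
* §3 `su2a0_inv_mul` — the quaternion inner product: `a₀(x⁻¹y) = a₀(x)a₀(y) + ⟨x⃗(x), x⃗(y)⟩`.
* §4 **`integral_su2Character_conv`** — THE CHARACTER CONVOLUTION IDENTITY: for every `x ∈ SU(2)`
  and all `m, n ∈ ℕ`,
  `∫ U_m(a₀(x⁻¹y))·U_n(a₀(y)) dHaar(y) = [m = n]·U_n(a₀(x))/(n+1)`,
  i.e. `χ_m ∗ χ_n = [m = n]·χ_n/dim` — equivalently, for all `A, B`:
  `∫ χ_m(A U) χ_n(U⁻¹B) dU = [m = n] χ_n(AB)/(n+1)` (`integral_su2Character_mul_conv`), the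
  face-merging rule of the 2-d character expansion.  For `x = ±1` it is orthonormality (and parity
  `U_n(−t) = (−1)ⁿU_n(t)`); otherwise `x = (cos θ, sin θ·m̂)` with `sin θ = ‖x⃗(x)‖ > 0` and §2 + the
  evaluated two-angle integral `SU2CharacterConvolution.twoAngle_integral_chebyshevU` apply.

NOT here (remaining steps, NOT TYPED): completeness of `{χ_n}` in the continuous class functions and
the handle identity `∫ χ_n(AUBU⁻¹) dU = χ_n(A)χ_n(B)/(n+1)`; the lattice assembly of
`Z_{(ℤ/L)²}^{SU(2)}(β) = Σ_n (c_n/(n+1))^{L²}`.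
-/

noncomputable section

open Real MeasureTheory intervalIntegral Set Metric Polynomial.Chebyshev ProbabilityTheory
open Literature.MathematicalPhysics.QuantumFieldTheory Literature.MathematicalPhysics.QuantumLattice
open Summit.Ventures.LatticeQCDFlow.Exactness
open Summit.Ventures.LatticeQCDFlow.Theory2.Lattice
open scoped RealInnerProductSpace

namespace Summit.Ventures.LatticeQCDFlow.Scoring

/-! ## §1. Archimedes in every direction: the law of `⟨m̂, n̂⟩` under `uniformSphere` -/

/-- `dirSphere` is equivariant under linear isometries (off the origin). -/
theorem dirSphere_linearIsometryEquiv (L : E3 ≃ₗᵢ[ℝ] E3) {y : E3} (hy : y ≠ 0) :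
    (dirSphere (L y) : E3) = L (dirSphere y : E3) := by
  have hLy : L y ≠ 0 := fun h => hy (by simpa using congrArg L.symm h)
  rw [dirSphere_coe hLy, dirSphere_coe hy, L.norm_map, L.map_smul]

/-- The origin is null for the standard Gaussian of `ℝ³`. -/
theorem stdGaussian_E3_singleton_zero : stdGaussian E3 {(0 : E3)} = 0 := by
  rw [stdGaussian_eq_withDensity_radial, withDensity_apply _ (measurableSet_singleton _),
    Measure.restrict_eq_zero.mpr (measure_singleton _), lintegral_zero_measure]

/-- The inner product with a fixed vector is a measurable function on the sphere. -/
theorem measurable_sphere_inner (m : E3) : Measurable fun n : sphere (0 : E3) 1 => ⟪m, (n : E3)⟫ :=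
  (continuous_const.inner continuous_subtype_val).measurable

/-- `|⟨m̂, n̂⟩| ≤ 1` for unit vectors: the projection lies in `[−1, 1]`. -/
theorem sphere_inner_mem_Icc {m : E3} (hm : ‖m‖ = 1) (n : sphere (0 : E3) 1) :
    ⟪m, (n : E3)⟫ ∈ Icc (-1 : ℝ) 1 := by
  have hn : ‖(n : E3)‖ = 1 := by simp
  have h := abs_real_inner_le_norm m (n : E3)
  rw [hm, hn, one_mul] at h
  exact abs_le.mp h

/-- **Archimedes' theorem in every direction.**  For a unit vector `m̂ ∈ ℝ³`, the law of
`⟨m̂, n̂⟩` for `n̂` uniform on `S²` (row 9's `uniformSphere`) is the uniform law `½·Lebesgue|[−1,1]`. -/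
theorem uniformSphere_map_inner {m : E3} (hm : ‖m‖ = 1) :
    (uniformSphere (volume : Measure E3)).map (fun n : sphere (0 : E3) 1 => ⟪m, (n : E3)⟫) =
      (2⁻¹ : NNReal) • (volume.restrict (Icc (-1 : ℝ) 1)) := by
  set e0 : E3 := EuclideanSpace.single 0 (1 : ℝ) with he0_def
  have he0 : ‖e0‖ = 1 := by simp [he0_def]
  have hcoord : ∀ v : E3, ⟪e0, v⟫ = v 0 := fun v => by
    rw [he0_def, EuclideanSpace.inner_single_left]; simp
  -- a linear isometry taking `m` to `e0`
  obtain ⟨L, hL⟩ : ∃ L : E3 ≃ₗᵢ[ℝ] E3, L m = e0 := by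
    by_cases h : m = e0
    · exact ⟨LinearIsometryEquiv.refl ℝ E3, by simp [h]⟩
    · exact ⟨(ℝ ∙ (m - e0))ᗮ.reflection, Submodule.reflection_sub (by rw [hm, he0])⟩
  rw [← stdGaussian_map_dirSphere, Measure.map_map (measurable_sphere_inner m) measurable_dirSphere]
  have hae : ((fun n : sphere (0 : E3) 1 => ⟪m, (n : E3)⟫) ∘ dirSphere) =ᵐ[stdGaussian E3]
      ((fun n : sphere (0 : E3) 1 => (n : E3) 0) ∘ dirSphere) ∘ L := by
    have hmem : {(0 : E3)}ᶜ ∈ ae (stdGaussian E3) := compl_mem_ae_iff.2 stdGaussian_E3_singleton_zero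
    filter_upwards [hmem] with g hg
    simp only [Function.comp_apply]
    rw [← hcoord, dirSphere_linearIsometryEquiv L hg, ← hL, LinearIsometryEquiv.inner_map_map]
  rw [Measure.map_congr hae,
    ← Measure.map_map ((measurable_sphere_coord 0).comp measurable_dirSphere) L.continuous.measurable,
    stdGaussian_map L,
    ← Measure.map_map (measurable_sphere_coord 0) measurable_dirSphere, stdGaussian_map_dirSphere,
    uniformSphere_map_coord_zero]

/-! ## §2. The product law of `(a₀, ⟨m̂, n̂⟩)` and the general two-angle disintegration -/

/-- The pair (`a₀`, `⟨m̂, axis⟩`) is measurable. -/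
theorem measurable_a0_axisProj (m : E3) :
    Measurable fun U : Matrix.specialUnitaryGroup (Fin 2) ℂ => (su2a0 U, ⟪m, (su2axis U : E3)⟫) :=
  continuous_su2a0.measurable.prodMk ((measurable_sphere_inner m).comp measurable_su2axis)

/-- **Product law**: under Haar, `a₀` and the axis projection `⟨m̂, n̂⟩` (unit `m̂`) are independent,
`a₀` semicircle-distributed and `⟨m̂, n̂⟩` uniform on `[−1, 1]`. -/
theorem map_a0_axisProj_haar {m : E3} (hm : ‖m‖ = 1) :
    (haarProbability (Matrix.specialUnitaryGroup (Fin 2) ℂ)).map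
        (fun U => (su2a0 U, ⟪m, (su2axis U : E3)⟫)) =
      semicircleLaw.prod ((2⁻¹ : NNReal) • (volume.restrict (Icc (-1 : ℝ) 1))) := by
  have hm' := measurable_sphere_inner m
  have h1 : (fun U : Matrix.specialUnitaryGroup (Fin 2) ℂ => (su2a0 U, ⟪m, (su2axis U : E3)⟫)) =
      (Prod.map id fun n : sphere (0 : E3) 1 => ⟪m, (n : E3)⟫) ∘ fun U => (su2a0 U, su2axis U) := by
    funext U; rfl
  rw [h1, ← Measure.map_map (measurable_id.prodMap hm') measurable_a0_axis, map_a0_axis_haar,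
    ← Measure.map_prod_map _ _ measurable_id hm', Measure.map_id, uniformSphere_map_inner hm]

/-- `⟨m̂, x⃗(U)⟩ = √(1 − a₀²)·⟨m̂, n̂(U)⟩` (for every `U`; both sides vanish at `U = ±1`). -/
theorem inner_su2vec_eq_sqrt_mul (m : E3) (U : Matrix.specialUnitaryGroup (Fin 2) ℂ) :
    ⟪m, su2vec U⟫ = Real.sqrt (1 - su2a0 U ^ 2) * ⟪m, (su2axis U : E3)⟫ := by
  rw [← norm_su2vec_eq]
  by_cases hv : su2vec U = 0
  · rw [hv, inner_zero_right, norm_zero, zero_mul]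
  · rw [su2axis, dirSphere_coe hv, inner_smul_right, ← mul_assoc,
      mul_inv_cancel₀ (norm_ne_zero_iff.mpr hv), one_mul]

/-- **The general two-angle disintegration of Haar measure on SU(2)**: for every unit `m̂ ∈ ℝ³` and
every continuous `F : ℝ → ℝ → ℝ`,
`∫ F(a₀(U), ⟨m̂, x⃗(U)⟩) dHaar(U) = ∫_{−1}^{1} (½∫_{−1}^{1} F(t, √(1 − t²)·s) ds)·(2/π)√(1 − t²) dt`. -/
theorem integral_a0_innerVec_haar {m : E3} (hm : ‖m‖ = 1) (F : ℝ → ℝ → ℝ)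
    (hF : Continuous (Function.uncurry F)) :
    ∫ U, F (su2a0 U) ⟪m, su2vec U⟫ ∂(haarProbability (Matrix.specialUnitaryGroup (Fin 2) ℂ)) =
      ∫ t in (-1 : ℝ)..1, (2⁻¹ * ∫ s in (-1 : ℝ)..1, F t (Real.sqrt (1 - t ^ 2) * s)) *
        semicircleDensity t := by
  set ν : Measure ℝ := (2⁻¹ : NNReal) • (volume.restrict (Icc (-1 : ℝ) 1)) with hν
  haveI : IsFiniteMeasure (volume.restrict (Icc (-1 : ℝ) 1)) :=
    ⟨by rw [Measure.restrict_apply_univ]; exact measure_Icc_lt_top⟩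
  have hG : Continuous fun p : ℝ × ℝ => F p.1 (Real.sqrt (1 - p.1 ^ 2) * p.2) := by
    have h1 : Continuous fun p : ℝ × ℝ => (p.1, Real.sqrt (1 - p.1 ^ 2) * p.2) := by fun_prop
    exact hF.comp h1
  have h1 : ∫ U, F (su2a0 U) ⟪m, su2vec U⟫ ∂(haarProbability (Matrix.specialUnitaryGroup (Fin 2) ℂ)) =
      ∫ p, F p.1 (Real.sqrt (1 - p.1 ^ 2) * p.2)
        ∂((haarProbability (Matrix.specialUnitaryGroup (Fin 2) ℂ)).map
          fun U => (su2a0 U, ⟪m, (su2axis U : E3)⟫)) := by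
    rw [integral_map (measurable_a0_axisProj m).aemeasurable hG.aestronglyMeasurable]
    refine integral_congr_ae (Filter.Eventually.of_forall fun U => ?_)
    simp only
    rw [inner_su2vec_eq_sqrt_mul]
  rw [h1, map_a0_axisProj_haar hm]
  obtain ⟨M, hM⟩ := (isCompact_Icc.prod isCompact_Icc : IsCompact (Icc (-1 : ℝ) 1 ×ˢ Icc (-1 : ℝ) 1))
    |>.exists_bound_of_continuousOn hG.continuousOn
  have hint : Integrable (fun p : ℝ × ℝ => F p.1 (Real.sqrt (1 - p.1 ^ 2) * p.2))
      (semicircleLaw.prod ν) :=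
    Integrable.mono' (integrable_const M) hG.aestronglyMeasurable
      (ae_mem_Icc_prod_Icc.mono fun p hp => hM p hp)
  rw [integral_prod _ hint, integral_semicircleLaw]
  refine intervalIntegral.integral_congr fun t _ => ?_
  simp only
  congr 1
  rw [hν, integral_smul_nnreal_measure]
  have h2 : ∫ s in Icc (-1 : ℝ) 1, F t (Real.sqrt (1 - t ^ 2) * s) =
      ∫ s in (-1 : ℝ)..1, F t (Real.sqrt (1 - t ^ 2) * s) := by
    rw [intervalIntegral.integral_of_le (by norm_num), integral_Icc_eq_integral_Ioc]
  rw [h2, NNReal.smul_def, smul_eq_mul]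
  push_cast
  ring

/-! ## §3. The quaternion inner product: `a₀(x⁻¹y) = a₀(x)a₀(y) + ⟨x⃗(x), x⃗(y)⟩` -/

/-- **`a₀(x⁻¹y) = a₀(x)·a₀(y) + Σ_k x_k(x)·x_k(y)`** — `Re tr(x†y)/2` is the Euclidean inner product
of `ℝ⁴ ⊃ S³ ≅ SU(2)` in the quaternion coordinates `(a₀, x₁, x₂, x₃)`. -/
theorem su2a0_inv_mul (x y : Matrix.specialUnitaryGroup (Fin 2) ℂ) :
    su2a0 (x⁻¹ * y) = su2a0 x * su2a0 y +
      (su2x genZ1 x * su2x genZ1 y + su2x genZ2 x * su2x genZ2 y + su2x genZ3 x * su2x genZ3 y) := by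
  have hx := IsQuat.of_mem_specialUnitaryGroup x.2
  have hy := IsQuat.of_mem_specialUnitaryGroup y.2
  have hinv : ((x⁻¹ : Matrix.specialUnitaryGroup (Fin 2) ℂ) : Matrix (Fin 2) (Fin 2) ℂ) =
      star (x : Matrix (Fin 2) (Fin 2) ℂ) := rfl
  simp only [su2a0, su2x, Submonoid.coe_mul, hinv, genZ1, genZ2, genZ3, Matrix.trace_fin_two,
    Matrix.mul_apply, Fin.sum_univ_two, Matrix.star_apply, Matrix.of_apply, Matrix.cons_val',
    Matrix.cons_val_zero, Matrix.cons_val_one, Matrix.empty_val', Matrix.cons_val_fin_one,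
    hx.diag, hx.offdiag, hy.diag, hy.offdiag, RCLike.star_def, Complex.add_re, Complex.mul_re,
    Complex.I_re, Complex.I_im, Complex.conj_re, Complex.conj_im, Complex.neg_re,
    Complex.neg_im, map_neg, Complex.zero_re, Complex.zero_im, Complex.one_re, Complex.one_im]
  ring

/-- `⟨x⃗(x), x⃗(y)⟩ = Σ_k x_k(x) x_k(y)` for the vector parts in `ℝ³`. -/
theorem inner_su2vec_su2vec (x y : Matrix.specialUnitaryGroup (Fin 2) ℂ) :
    ⟪su2vec x, su2vec y⟫ =
      su2x genZ1 x * su2x genZ1 y + su2x genZ2 x * su2x genZ2 y + su2x genZ3 x * su2x genZ3 y := by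
  rw [real_inner_comm, PiLp.inner_apply, Fin.sum_univ_three]
  simp [su2vec]

/-- **`a₀(x⁻¹y) = a₀(x)a₀(y) + ⟨x⃗(x), x⃗(y)⟩`.** -/
theorem su2a0_inv_mul_eq_inner (x y : Matrix.specialUnitaryGroup (Fin 2) ℂ) :
    su2a0 (x⁻¹ * y) = su2a0 x * su2a0 y + ⟪su2vec x, su2vec y⟫ := by
  rw [su2a0_inv_mul, inner_su2vec_su2vec]

/-! ## §4. The character convolution identity for every `x ∈ SU(2)` -/

/-- `a₀(g⁻¹) = a₀(g)` (`Re tr U† = Re tr U`). -/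
theorem su2a0_inv (g : Matrix.specialUnitaryGroup (Fin 2) ℂ) : su2a0 g⁻¹ = su2a0 g := by
  have hinv : ((g⁻¹ : Matrix.specialUnitaryGroup (Fin 2) ℂ) : Matrix (Fin 2) (Fin 2) ℂ) =
      star (g : Matrix (Fin 2) (Fin 2) ℂ) := rfl
  rw [su2a0, su2a0, hinv, Matrix.star_eq_conjTranspose, Matrix.trace_conjTranspose, Complex.star_def,
    Complex.conj_re]

/-- **THE CHARACTER CONVOLUTION IDENTITY ON SU(2).**  For every `x ∈ SU(2)` and all `m, n ∈ ℕ`: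
`∫ U_m(a₀(x⁻¹y))·U_n(a₀(y)) dHaar(y) = [m = n]·U_n(a₀(x))/(n+1)`, i.e. for the characters
`χ_n = U_n(a₀)` of the `(n+1)`-dimensional irreducible representations,
`(χ_m ∗ χ_n)(x) = [m = n]·χ_n(x)/(n+1)` — proved by the two-angle computation, without Peter–Weyl. -/
theorem integral_su2Character_conv (x : Matrix.specialUnitaryGroup (Fin 2) ℂ) (m n : ℕ) :
    ∫ y, (U ℝ m).eval (su2a0 (x⁻¹ * y)) * (U ℝ n).eval (su2a0 y)
        ∂(haarProbability (Matrix.specialUnitaryGroup (Fin 2) ℂ)) =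
      if m = n then (U ℝ n).eval (su2a0 x) / (n + 1) else 0 := by
  simp_rw [su2a0_inv_mul_eq_inner]
  by_cases hv : su2vec x = 0
  · -- `x = ±1`: `a₀(x) = ±1`, `a₀(x⁻¹y) = ±a₀(y)`
    simp_rw [hv, inner_zero_left, add_zero]
    have hsq : su2a0 x ^ 2 = 1 := by
      have h := norm_su2vec_sq x
      rw [hv, norm_zero] at h
      nlinarith [h]
    rcases sq_eq_one_iff.mp hsq with h1 | h1
    · simp_rw [h1, one_mul]
      rw [integral_su2Character_mul_su2Character m n]
      by_cases h : m = n
      · subst h; rw [if_pos rfl, if_pos rfl, chebyshevU_eval_one_nat]; field_simp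
      · rw [if_neg h, if_neg h]
    · simp_rw [h1, neg_one_mul, U_eval_neg, mul_assoc]
      rw [MeasureTheory.integral_const_mul, integral_su2Character_mul_su2Character m n]
      by_cases h : m = n
      · subst h
        rw [if_pos rfl, if_pos rfl, chebyshevU_eval_one_nat]
        field_simp
      · rw [if_neg h, if_neg h, mul_zero]
  · -- generic `x`: `a₀(x) = cos θ`, `‖x⃗(x)‖ = sin θ > 0`, `x⃗(x) = sin θ·m̂`
    have hvn : 0 < ‖su2vec x‖ := norm_pos_iff.mpr hv
    have hmhat1 : ‖(su2axis x : E3)‖ = 1 := by simp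
    have hvec : su2vec x = ‖su2vec x‖ • (su2axis x : E3) := by
      rw [su2axis, dirSphere_coe hv, smul_smul, mul_inv_cancel₀ hvn.ne', one_smul]
    -- the angle θ ∈ [0, π] with cos θ = a₀(x), sin θ = ‖x⃗(x)‖
    have ha : |su2a0 x| ≤ 1 := abs_su2a0_le_one x
    have hcos : Real.cos (Real.arccos (su2a0 x)) = su2a0 x :=
      Real.cos_arccos (abs_le.mp ha).1 (abs_le.mp ha).2
    have hsin : Real.sin (Real.arccos (su2a0 x)) = ‖su2vec x‖ := by
      rw [Real.sin_arccos, norm_su2vec_eq]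
    have hsin0 : Real.sin (Real.arccos (su2a0 x)) ≠ 0 := by rw [hsin]; exact hvn.ne'
    have hpt : ∀ y : Matrix.specialUnitaryGroup (Fin 2) ℂ,
        su2a0 x * su2a0 y + ⟪su2vec x, su2vec y⟫ =
          Real.cos (Real.arccos (su2a0 x)) * su2a0 y +
            Real.sin (Real.arccos (su2a0 x)) * ⟪(su2axis x : E3), su2vec y⟫ := by
      intro y
      rw [hcos, hsin]
      conv_lhs => rw [hvec]
      rw [real_inner_smul_left]
    simp_rw [hpt]
    have hF : Continuous (Function.uncurry fun t u : ℝ =>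
        (U ℝ m).eval (Real.cos (Real.arccos (su2a0 x)) * t + Real.sin (Real.arccos (su2a0 x)) * u) *
          (U ℝ n).eval t) := by
      have h1 : Continuous fun p : ℝ × ℝ =>
          Real.cos (Real.arccos (su2a0 x)) * p.1 + Real.sin (Real.arccos (su2a0 x)) * p.2 := by
        fun_prop
      exact ((U ℝ m).continuous.comp h1).mul ((U ℝ n).continuous.comp continuous_fst)
    rw [integral_a0_innerVec_haar hmhat1 (fun t u => (U ℝ m).eval
      (Real.cos (Real.arccos (su2a0 x)) * t + Real.sin (Real.arccos (su2a0 x)) * u) *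
      (U ℝ n).eval t) hF, twoAngle_integral_chebyshevU m n hsin0, hcos]

/-- **The face-merging rule of the character expansion**: for all `A, B ∈ SU(2)` and `m, n ∈ ℕ`,
`∫ χ_m(A·V)·χ_n(V⁻¹·B) dV = [m = n]·χ_n(A·B)/(n+1)` (`χ_n = U_n(a₀)`): left invariance `V ↦ A⁻¹V`
and `a₀(W⁻¹·AB) = a₀((AB)⁻¹·W)` reduce it to `integral_su2Character_conv` at `x = AB`. -/
theorem integral_su2Character_mul_conv (A B : Matrix.specialUnitaryGroup (Fin 2) ℂ) (m n : ℕ) :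
    ∫ V, (U ℝ m).eval (su2a0 (A * V)) * (U ℝ n).eval (su2a0 (V⁻¹ * B))
        ∂(haarProbability (Matrix.specialUnitaryGroup (Fin 2) ℂ)) =
      if m = n then (U ℝ n).eval (su2a0 (A * B)) / (n + 1) else 0 := by
  have h := integral_mul_left_eq_self (μ := haarProbability (Matrix.specialUnitaryGroup (Fin 2) ℂ))
    (fun W : Matrix.specialUnitaryGroup (Fin 2) ℂ =>
      (U ℝ m).eval (su2a0 W) * (U ℝ n).eval (su2a0 (W⁻¹ * (A * B)))) A
  have hl : ∀ V : Matrix.specialUnitaryGroup (Fin 2) ℂ, (A * V)⁻¹ * (A * B) = V⁻¹ * B := fun V => by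
    group
  simp_rw [hl] at h
  rw [h]
  have hr : (fun W : Matrix.specialUnitaryGroup (Fin 2) ℂ =>
      (U ℝ m).eval (su2a0 W) * (U ℝ n).eval (su2a0 (W⁻¹ * (A * B)))) =
      fun W => (U ℝ n).eval (su2a0 ((A * B)⁻¹ * W)) * (U ℝ m).eval (su2a0 W) := by
    funext W
    rw [← su2a0_inv (W⁻¹ * (A * B)), mul_inv_rev, inv_inv, mul_comm]
  rw [hr, integral_su2Character_conv (A * B) n m]
  by_cases hmn : m = n
  · subst hmn; rfl
  · rw [if_neg (Ne.symm hmn), if_neg hmn]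

end Summit.Ventures.LatticeQCDFlow.Scoring
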